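import Mathlib
import Literature.NumberTheory.Transcendental.ZagierDilogarithmConjecture
import Literature.NumberTheory.Transcendental.PreBlochHalf
import HarnessLib

/-!
# `ZagierDilogarithmConjecture` (stmt-KontsevichZagierPeriods-10550) — line
`kummer-clausen-linearisation`, stub `stub_twoSaturation`

**2-saturation of the dilogarithm relator group.** If `2x` lies in the subgroup
`C = ⟨dilogRelators⟩` of `ℤ[ℂ]` (five-term elements with algebraic entries, `[w] + [w̄]` for
algebraic `w`, `[r]` for real `r`), then so does `x`: the prime-`2` part of "`ℤ`-form ⇔ `ℚ`-form"
of Zagier's conjecture (Neumann 1998, remark after Thm. 2.10 [Neumann1998]), from the tree's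
PROVED unique `2`-divisibility of the pre-Bloch group `P(K)` of the algebraically closed field
`K = ℚ̄ = algebraicClosure ℚ ℂ` (Dupont 2001, Thm. 8.16, `n = 2` [Dupont2001]:
`PreBloch.two_nsmul_injective`, `PreBloch.nsmul_surjective`).

Proof. (§1) `x = πA x + (x − πA x − πT x) + πT x` (generators in `K` / real generators off `K` /
the others): `πT` kills `C` and `ℤ[ℂ]` has no `2`-torsion, so `πT x = 0`; the middle term lies
in `C`; `πA` maps `C` into `C`. (§2) Complex conjugation `σ` of `K` acts on `P(K)` by `c`; the
image `N = Φ(C_N)` of the symmetric relators `C_N = ⟨[w] + [w̄], [r]⟩` under the symbol map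
`Φ : ℤ[ℂ] → P(K)` is fixed by `c` and contains all `⟦z⟧ + ⟦σ z⟧`, hence (halving in `P(K)`) it
is `2`-saturated; `Φ(C) ⊆ N`, so `Φ x ∈ N`, `Φ x = Φ n` with `n ∈ C_N ⊆ C`. (§3) `Φ = proj ∘ λ`;
`ker proj` is spanned by the five-term relators of `ℤ[K ∖ {0,1}]`, which come back to five-term
dilogarithm relators, and `[0], [1]` are real relators; hence `πA (x − n) ∈ C` and `πA x ∈ C`.
-/

noncomputable section

open scoped ComplexConjugate
open Literature.NumberTheory.Transcendental
open FreeAbelianGroup (of lift_apply_of)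

namespace Summit.KontsevichZagierPeriods.HyperbolicBloch.ZagierDilogarithm

variable {K : IntermediateField ℚ ℂ}

/-! ## §1 Support split of `ℤ[ℂ]` along a conjugation-stable subfield `K ⊇ ℚ̄` -/

/-- `ℤ[ℂ]` has no `2`-torsion. [folklore] -/
theorem eq_zero_of_two_nsmul_eq_zero {x : FreeAbelianGroup ℂ} (h : 2 • x = 0) : x = 0 := by
  have h2 := congrArg (FreeAbelianGroup.equivFinsupp ℂ) h
  rw [map_nsmul, map_zero] at h2
  have h3 := (smul_eq_zero.1 h2).resolve_left (by norm_num)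
  exact (FreeAbelianGroup.equivFinsupp ℂ).injective (by rw [h3, map_zero])

/-- The last three arguments of a five-term relator with entries in `K` lie in `K`. [folklore] -/
theorem fiveTerm_args_mem {x y : ℂ} (hx : x ∈ K) (hy : y ∈ K) :
    y / x ∈ K ∧ (1 - x⁻¹) / (1 - y⁻¹) ∈ K ∧ (1 - x) / (1 - y) ∈ K :=
  ⟨div_mem hy hx, div_mem (sub_mem (one_mem K) (inv_mem hx)) (sub_mem (one_mem K) (inv_mem hy)),
    div_mem (sub_mem (one_mem K) hx) (sub_mem (one_mem K) hy)⟩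

/-- An endomorphism of `ℤ[ℂ]` killing the generators in `K` and the real generators kills every
dilogarithm relator, hence the relator subgroup. [folklore] -/
theorem closure_le_ker_of_transcendental (hKa : ∀ z, IsAlgebraic ℚ z → z ∈ K)
    (hKc : ∀ z, z ∈ K → conj z ∈ K) (π : FreeAbelianGroup ℂ →+ FreeAbelianGroup ℂ)
    (ha : ∀ z, z ∈ K → π (of z) = 0) (hr : ∀ z : ℂ, z.im = 0 → π (of z) = 0) :
    AddSubgroup.closure dilogRelators ≤ π.ker := by
  refine (AddSubgroup.closure_le _).2 ?_
  rintro r ((⟨x, y, hx, hy, -, -, -, -, -, rfl⟩ | ⟨w, hw, rfl⟩) | ⟨w, hw, rfl⟩)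
  · obtain ⟨h3, h4, h5⟩ := fiveTerm_args_mem (hKa x hx) (hKa y hy)
    simp only [SetLike.mem_coe, AddMonoidHom.mem_ker, map_add, map_sub, ha x (hKa x hx),
      ha y (hKa y hy), ha _ h3, ha _ h4, ha _ h5, sub_zero, add_zero]
  · simp only [SetLike.mem_coe, AddMonoidHom.mem_ker, map_add, ha w (hKa w hw),
      ha _ (hKc w (hKa w hw)), add_zero]
  · simpa only [SetLike.mem_coe, AddMonoidHom.mem_ker] using hr w hw

/-- An endomorphism of `ℤ[ℂ]` fixing the generators in `K` and killing the other ones maps the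
relator subgroup into itself. [folklore] -/
theorem closure_le_comap_of_algebraic (hKa : ∀ z, IsAlgebraic ℚ z → z ∈ K)
    (hKc : ∀ z, z ∈ K → conj z ∈ K) (π : FreeAbelianGroup ℂ →+ FreeAbelianGroup ℂ)
    (ha : ∀ z, z ∈ K → π (of z) = of z) (hn : ∀ z, z ∉ K → π (of z) = 0) :
    AddSubgroup.closure dilogRelators ≤ (AddSubgroup.closure dilogRelators).comap π := by
  refine (AddSubgroup.closure_le _).2 ?_
  rintro r hr
  simp only [SetLike.mem_coe, AddSubgroup.mem_comap]
  rcases hr with ((⟨x, y, hx, hy, hx0, hx1, hy0, hy1, hxy, rfl⟩ | ⟨w, hw, rfl⟩) | ⟨w, hw, rfl⟩)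
  · obtain ⟨h3, h4, h5⟩ := fiveTerm_args_mem (hKa x hx) (hKa y hy)
    simp only [map_add, map_sub, ha x (hKa x hx), ha y (hKa y hy), ha _ h3, ha _ h4, ha _ h5]
    exact AddSubgroup.subset_closure (fiveTerm_mem_dilogRelators hx hy hx0 hx1 hy0 hy1 hxy)
  · simp only [map_add, ha w (hKa w hw), ha _ (hKc w (hKa w hw))]
    exact AddSubgroup.subset_closure (of_add_of_conj_mem_dilogRelators hw)
  · by_cases hw' : w ∈ K
    · rw [ha w hw']; exact AddSubgroup.subset_closure (of_real_mem_dilogRelators hw)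
    · rw [hn w hw']; exact zero_mem _

/-! ## §2 Complex conjugation on `K` and on `P(K)`; the symmetric part is `2`-saturated -/

/-- Complex conjugation restricts to a ring endomorphism of a conjugation-stable subfield.
[folklore] -/
theorem exists_conj_ringHom (hKc : ∀ z, z ∈ K → conj z ∈ K) :
    ∃ σ : K →+* K, ∀ z : K, ((σ z : K) : ℂ) = conj (z : ℂ) :=
  ⟨{ toFun := fun z => ⟨conj (z : ℂ), hKc z z.2⟩
     map_one' := Subtype.ext (by simp)
     map_mul' := fun a b => Subtype.ext (by simp)
     map_zero' := Subtype.ext (by simp)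
     map_add' := fun a b => Subtype.ext (by simp) }, fun _ => rfl⟩

/-- A ring endomorphism `σ` of a field `F` induces an additive endomorphism `c` of `P(F)` with
`c ⟦z⟧ = ⟦σ z⟧` (the five-term relator at `(x, y)` goes to the one at `(σ x, σ y)`). [folklore] -/
theorem exists_conj_preBloch {F : Type*} [Field F] (σ : F →+* F) :
    ∃ c : PreBloch F →+ PreBloch F, ∀ z : F, c (PreBloch.sym z) = PreBloch.sym (σ z) := by
  let ct : FreeAbelianGroup (PreBloch.Gen F) →+ PreBloch F :=
    FreeAbelianGroup.lift fun g => PreBloch.sym (σ g.val)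
  have hle : AddSubgroup.closure (fiveTermRelators F) ≤ ct.ker := by
    refine (AddSubgroup.closure_le _).2 ?_
    rintro r ⟨x, y, hxy, rfl⟩
    have hx : σ x.val ≠ 0 ∧ σ x.val ≠ 1 :=
      ⟨(map_ne_zero σ).2 x.val_ne_zero, fun e => x.val_ne_one (σ.injective (by rw [e, map_one]))⟩
    have hy : σ y.val ≠ 0 ∧ σ y.val ≠ 1 :=
      ⟨(map_ne_zero σ).2 y.val_ne_zero, fun e => y.val_ne_one (σ.injective (by rw [e, map_one]))⟩
    have hxy' : σ x.val ≠ σ y.val := fun e => hxy (σ.injective e)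
    simp only [SetLike.mem_coe, AddMonoidHom.mem_ker, fiveTermRelator, map_add, map_sub, ct,
      lift_apply_of, PreBloch.Gen.val_quot, PreBloch.Gen.val_quotInv,
      PreBloch.Gen.val_quotSub, map_div₀, map_one, map_inv₀]
    exact PreBloch.sym_five_term hx hy hxy'
  refine ⟨QuotientAddGroup.lift (AddSubgroup.closure (fiveTermRelators F)) ct hle, fun z => ?_⟩
  by_cases hz : z ≠ 0 ∧ z ≠ 1
  · rw [PreBloch.sym_of_ne hz]
    exact (lift_apply_of _ _ : ct (of ⟨z, hz⟩) = _)
  · rw [PreBloch.sym_of_not hz, map_zero]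
    have hz' : ¬(σ z ≠ 0 ∧ σ z ≠ 1) := fun h =>
      hz ⟨fun e => h.1 (by rw [e, map_zero]), fun e => h.2 (by rw [e, map_one])⟩
    rw [PreBloch.sym_of_not hz']

/-- If an additive subgroup `N` of `P(F)` (`F` algebraically closed of characteristic `0`) is
fixed pointwise by an endomorphism `c` and contains `⟦z⟧ + c ⟦z⟧` for every `z`, then `N` is
`2`-saturated: `2y ∈ N → y ∈ N` (no `2`-torsion and `2`-divisibility of `P(F)`, Dupont 2001
Thm. 8.16 for `n = 2`). [cite: Dupont2001, Thm. 8.16] -/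
theorem two_saturated_of_fixed {F : Type*} [Field F] [IsAlgClosed F] [CharZero F]
    (c : PreBloch F →+ PreBloch F) (N : AddSubgroup (PreBloch F)) (hfix : ∀ n ∈ N, c n = n)
    (hgen : ∀ z : F, PreBloch.sym z + c (PreBloch.sym z) ∈ N) (y : PreBloch F)
    (hy : 2 • y ∈ N) : y ∈ N := by
  have hinj := PreBloch.two_nsmul_injective (F := F)
  have hcy : c y = y := hinj (show 2 • c y = 2 • y by rw [← map_nsmul]; exact hfix _ hy)
  obtain ⟨y', rfl⟩ := PreBloch.nsmul_surjective (F := F) two_pos y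
  simp only at hy hcy ⊢
  have hcy' : c y' = y' := hinj (show 2 • c y' = 2 • y' by rw [← map_nsmul]; exact hcy)
  have key : ∀ ξ : FreeAbelianGroup (PreBloch.Gen F),
      PreBloch.proj ξ + c (PreBloch.proj ξ) ∈ N := by
    intro ξ
    induction ξ using FreeAbelianGroup.induction_on with
    | zero => rw [map_zero, map_zero, add_zero]; exact zero_mem _
    | of g =>
      rw [PreBloch.proj_of, ← PreBloch.sym_of_ne]
      exact hgen g.val
    | neg g ih =>
      rw [map_neg, map_neg, ← neg_add]
      exact neg_mem ih
    | add u v hu hv =>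
      rw [map_add, map_add, add_add_add_comm]
      exact add_mem hu hv
  obtain ⟨ξ, rfl⟩ := PreBloch.proj_surjective y'
  rw [two_nsmul]
  simpa only [hcy'] using key ξ

/-! ## §3 From `ℤ[ℂ]` to `P(K)` and back -/

/-- The five-term relation in `P(K)` for symbols of complex numbers of `K`.
[cite: Neumann1998, §2 eq. (2.3)] -/
theorem sym_five_term_coe {x y : ℂ} (hx : x ∈ K) (hy : y ∈ K) (hx0 : x ≠ 0) (hx1 : x ≠ 1)
    (hy0 : y ≠ 0) (hy1 : y ≠ 1) (hxy : x ≠ y) (h3 : y / x ∈ K)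
    (h4 : (1 - x⁻¹) / (1 - y⁻¹) ∈ K) (h5 : (1 - x) / (1 - y) ∈ K) :
    PreBloch.sym (⟨x, hx⟩ : K) - PreBloch.sym (⟨y, hy⟩ : K) + PreBloch.sym (⟨y / x, h3⟩ : K) -
        PreBloch.sym (⟨(1 - x⁻¹) / (1 - y⁻¹), h4⟩ : K) +
        PreBloch.sym (⟨(1 - x) / (1 - y), h5⟩ : K) = 0 := by
  have e3 : (⟨y / x, h3⟩ : K) = ⟨y, hy⟩ / ⟨x, hx⟩ := rfl
  have e4 : (⟨(1 - x⁻¹) / (1 - y⁻¹), h4⟩ : K) = (1 - (⟨x, hx⟩ : K)⁻¹) / (1 - (⟨y, hy⟩ : K)⁻¹) :=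
    Subtype.ext (by push_cast; rfl)
  have e5 : (⟨(1 - x) / (1 - y), h5⟩ : K) = (1 - (⟨x, hx⟩ : K)) / (1 - (⟨y, hy⟩ : K)) :=
    Subtype.ext (by push_cast; rfl)
  rw [e3, e4, e5]
  exact PreBloch.sym_five_term
    ⟨fun e => hx0 (congrArg Subtype.val e), fun e => hx1 (congrArg Subtype.val e)⟩
    ⟨fun e => hy0 (congrArg Subtype.val e), fun e => hy1 (congrArg Subtype.val e)⟩
    (fun e => hxy (congrArg Subtype.val e))

/-- The symbol map `Φ : ℤ[ℂ] → P(K)` (`[z] ↦ ⟦z⟧` for `z ∈ K`, else `0`) sends the relator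
subgroup into the image `N` of the symmetric relators `[w] + [w̄]`, `[r]` (`w, r ∈ K`, `r` real):
the five-term relators die in `P(K)`. [cite: Neumann1998, §2 eq. (2.3)] -/
theorem closure_le_comap_sym (hKa : ∀ z, IsAlgebraic ℚ z → z ∈ K)
    (Φ : FreeAbelianGroup ℂ →+ PreBloch K)
    (hΦa : ∀ (z : ℂ) (h : z ∈ K), Φ (of z) = PreBloch.sym (⟨z, h⟩ : K))
    (hΦt : ∀ z : ℂ, z ∉ K → Φ (of z) = 0) :
    AddSubgroup.closure dilogRelators ≤
      ((AddSubgroup.closure ({c : FreeAbelianGroup ℂ | ∃ w : ℂ, w ∈ K ∧ c = of w + of (conj w)} ∪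
        {c | ∃ w : ℂ, w ∈ K ∧ w.im = 0 ∧ c = of w})).map Φ).comap Φ := by
  refine (AddSubgroup.closure_le _).2 ?_
  rintro r hr
  simp only [SetLike.mem_coe, AddSubgroup.mem_comap]
  rcases hr with ((⟨x, y, hx, hy, hx0, hx1, hy0, hy1, hxy, rfl⟩ | ⟨w, hw, rfl⟩) | ⟨w, hw, rfl⟩)
  · obtain ⟨h3, h4, h5⟩ := fiveTerm_args_mem (hKa x hx) (hKa y hy)
    rw [map_add, map_sub, map_add, map_sub, hΦa x (hKa x hx), hΦa y (hKa y hy), hΦa _ h3,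
      hΦa _ h4, hΦa _ h5, sym_five_term_coe (hKa x hx) (hKa y hy) hx0 hx1 hy0 hy1 hxy]
    exact zero_mem _
  · exact AddSubgroup.mem_map_of_mem Φ (AddSubgroup.subset_closure (Or.inl ⟨w, hKa w hw, rfl⟩))
  · by_cases hw' : w ∈ K
    · exact AddSubgroup.mem_map_of_mem Φ (AddSubgroup.subset_closure (Or.inr ⟨w, hw', hw, rfl⟩))
    · rw [hΦt w hw']
      exact zero_mem _

/-- `Φ = proj ∘ λ`, where `λ [z] = [z]` for `z ∈ K ∖ {0, 1}` and `λ [z] = 0` otherwise; and the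
`K`-part `πA v` differs from `ι (λ v)` (`ι [g] = [g]`) by a combination of the real relators
`[0]`, `[1]`. [folklore] -/
theorem lambda_facts (Φ : FreeAbelianGroup ℂ →+ PreBloch K)
    (hΦa : ∀ (z : ℂ) (h : z ∈ K), Φ (of z) = PreBloch.sym (⟨z, h⟩ : K))
    (hΦt : ∀ z : ℂ, z ∉ K → Φ (of z) = 0) (πA : FreeAbelianGroup ℂ →+ FreeAbelianGroup ℂ)
    (hA₁ : ∀ z, z ∈ K → πA (of z) = of z) (hA₂ : ∀ z, z ∉ K → πA (of z) = 0)
    (lam : FreeAbelianGroup ℂ →+ FreeAbelianGroup (PreBloch.Gen K))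
    (hl₁ : ∀ z : ℂ, z ∈ K ∧ z ≠ 0 ∧ z ≠ 1 →
      ∃ g : PreBloch.Gen K, (g.val : ℂ) = z ∧ lam (of z) = of g)
    (hl₂ : ∀ z : ℂ, ¬(z ∈ K ∧ z ≠ 0 ∧ z ≠ 1) → lam (of z) = 0)
    (ι : FreeAbelianGroup (PreBloch.Gen K) →+ FreeAbelianGroup ℂ)
    (hι : ∀ g, ι (of g) = of (g.val : ℂ)) (v : FreeAbelianGroup ℂ) :
    Φ v = PreBloch.proj (lam v) ∧ πA v - ι (lam v) ∈ AddSubgroup.closure dilogRelators := by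
  induction v using FreeAbelianGroup.induction_on with
  | zero => simp only [map_zero, sub_zero]; exact ⟨trivial, zero_mem _⟩
  | of z =>
    by_cases h : z ∈ K ∧ z ≠ 0 ∧ z ≠ 1
    · obtain ⟨g, hg, e⟩ := hl₁ z h
      rw [e, PreBloch.proj_of, hΦa z h.1, ← PreBloch.sym_of_ne, hι, hg, hA₁ z h.1, sub_self]
      exact ⟨congrArg _ (Subtype.ext hg.symm), zero_mem _⟩
    rw [hl₂ z h, map_zero, map_zero, sub_zero]
    by_cases ha : z ∈ K
    · have hz : z = 0 ∨ z = 1 := by tauto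
      rw [hΦa z ha, hA₁ z ha]
      refine ⟨PreBloch.sym_of_not fun hne => ?_, AddSubgroup.subset_closure
        (of_real_mem_dilogRelators (by rcases hz with rfl | rfl <;> simp))⟩
      rcases hz with rfl | rfl
      exacts [hne.1 (Subtype.ext rfl), hne.2 (Subtype.ext rfl)]
    · rw [hΦt z ha, hA₂ z ha]
      exact ⟨rfl, zero_mem _⟩
  | neg z ih =>
    simp only [map_neg, ih.1, neg_sub_neg, true_and]
    rw [← neg_sub]
    exact neg_mem ih.2
  | add u v hu hv =>
    simp only [map_add, hu.1, hv.1, true_and]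
    rw [add_sub_add_comm]
    exact add_mem hu.2 hv.2

/-- `ι [g] = [g]` maps the five-term relators of `ℤ[K ∖ {0,1}]` (`K ⊆ ℚ̄`) to five-term
dilogarithm relators, hence their span into the relator subgroup.
[cite: Neumann1998, §2 eq. (2.3)] -/
theorem closure_fiveTerm_le_comap (hKa' : ∀ z, z ∈ K → IsAlgebraic ℚ z)
    (ι : FreeAbelianGroup (PreBloch.Gen K) →+ FreeAbelianGroup ℂ)
    (hι : ∀ g, ι (of g) = of (g.val : ℂ)) :
    AddSubgroup.closure (fiveTermRelators K) ≤ (AddSubgroup.closure dilogRelators).comap ι := by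
  refine (AddSubgroup.closure_le _).2 ?_
  rintro r ⟨X, Y, hXY, rfl⟩
  simp only [SetLike.mem_coe, AddSubgroup.mem_comap, fiveTermRelator, map_add, map_sub, hι,
    PreBloch.Gen.val_quot, PreBloch.Gen.val_quotInv, PreBloch.Gen.val_quotSub]
  have hx0 : (X.val : ℂ) ≠ 0 := fun e => X.val_ne_zero (by exact_mod_cast e)
  have hx1 : (X.val : ℂ) ≠ 1 := fun e => X.val_ne_one (by exact_mod_cast e)
  have hy0 : (Y.val : ℂ) ≠ 0 := fun e => Y.val_ne_zero (by exact_mod_cast e)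
  have hy1 : (Y.val : ℂ) ≠ 1 := fun e => Y.val_ne_one (by exact_mod_cast e)
  have hxy : (X.val : ℂ) ≠ Y.val := fun e => hXY (Subtype.ext e)
  push_cast
  exact AddSubgroup.subset_closure (fiveTerm_mem_dilogRelators (hKa' _ X.val.2) (hKa' _ Y.val.2)
    hx0 hx1 hy0 hy1 hxy)

/-- Some `z ∈ K ∖ {0, 1}`, viewed in `K`, is still `∉ {0, 1}`. [folklore] -/
theorem coe_ne_zero_one {z : ℂ} (h : z ∈ K ∧ z ≠ 0 ∧ z ≠ 1) :
    (⟨z, h.1⟩ : K) ≠ 0 ∧ (⟨z, h.1⟩ : K) ≠ 1 :=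
  ⟨fun e => h.2.1 (congrArg Subtype.val e), fun e => h.2.2 (congrArg Subtype.val e)⟩

/-- **2-saturation of the dilogarithm relator group** (stub `stub_twoSaturation` of line
`kummer-clausen-linearisation`): if `2x ∈ ⟨dilogRelators⟩ ⊆ ℤ[ℂ]` then `x ∈ ⟨dilogRelators⟩`.
The prime-`2` part of "`ℤ`-form ⇔ `ℚ`-form" (Neumann 1998, remark after Thm. 2.10), from
the unique `2`-divisibility of `P(ℚ̄)` (Dupont 2001, Thm. 8.16, `n = 2`).
[cite: Dupont2001, Thm. 8.16] -/
theorem stub_twoSaturation :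
    ∀ x : FreeAbelianGroup ℂ, 2 • x ∈ AddSubgroup.closure dilogRelators →
      x ∈ AddSubgroup.closure dilogRelators := by
  classical
  intro x hx
  -- the algebraically closed field `K = ℚ̄ ⊆ ℂ` of algebraic numbers
  obtain ⟨K, hK0, hK⟩ : ∃ K : IntermediateField ℚ ℂ, IsAlgClosed K ∧ ∀ z, z ∈ K ↔ IsAlgebraic ℚ z :=
    ⟨algebraicClosure ℚ ℂ, (algebraicClosure.isAlgClosure ℚ ℂ).isAlgClosed,
      fun _ => mem_algebraicClosure_iff⟩
  have hKa : ∀ z, IsAlgebraic ℚ z → z ∈ K := fun z => (hK z).2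
  have hKa' : ∀ z, z ∈ K → IsAlgebraic ℚ z := fun z => (hK z).1
  have hKc : ∀ z, z ∈ K → conj z ∈ K :=
    fun z hz => hKa _ (by simpa using (hKa' z hz).algHom (starRingEnd ℂ).toRatAlgHom)
  -- §1: the support split
  let πA : FreeAbelianGroup ℂ →+ FreeAbelianGroup ℂ :=
    FreeAbelianGroup.lift fun z => if z ∈ K then of z else 0
  let πT : FreeAbelianGroup ℂ →+ FreeAbelianGroup ℂ :=
    FreeAbelianGroup.lift fun z => if z ∉ K ∧ z.im ≠ 0 then of z else 0
  have hA₁ : ∀ z, z ∈ K → πA (of z) = of z :=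
    fun z hz => by simp only [πA, lift_apply_of, if_pos hz]
  have hA₂ : ∀ z, z ∉ K → πA (of z) = 0 :=
    fun z hz => by simp only [πA, lift_apply_of, if_neg hz]
  have hTz : ∀ z, πT (of z) = if z ∉ K ∧ z.im ≠ 0 then of z else 0 :=
    fun z => lift_apply_of _ _
  have hT0 : πT x = 0 := by
    apply eq_zero_of_two_nsmul_eq_zero
    rw [← map_nsmul]
    exact (AddMonoidHom.mem_ker).1 (closure_le_ker_of_transcendental hKa hKc πT
      (fun z hz => by rw [hTz, if_neg fun h => h.1 hz])
      (fun z hz => by rw [hTz, if_neg fun h => h.2 hz]) hx)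
  have hR : ∀ v, v - πA v - πT v ∈ AddSubgroup.closure dilogRelators := by
    intro v
    induction v using FreeAbelianGroup.induction_on with
    | zero => simp only [map_zero, sub_zero]; exact zero_mem _
    | of z =>
      by_cases ha : z ∈ K
      · rw [hA₁ z ha, hTz, if_neg fun h => h.1 ha, sub_self, sub_zero]
        exact zero_mem _
      by_cases hr : z.im = 0
      · rw [hA₂ z ha, hTz, if_neg fun h => h.2 hr, sub_zero, sub_zero]
        exact AddSubgroup.subset_closure (of_real_mem_dilogRelators hr)
      · rw [hA₂ z ha, hTz, if_pos ⟨ha, hr⟩, sub_zero, sub_self]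
        exact zero_mem _
    | neg z ih =>
      rw [map_neg, map_neg, ← neg_sub', ← neg_sub']
      exact neg_mem ih
    | add u v hu hv =>
      rw [map_add, map_add, add_sub_add_comm, add_sub_add_comm]
      exact add_mem hu hv
  have hAC := closure_le_comap_of_algebraic hKa hKc πA hA₁ hA₂
  suffices hy : πA x ∈ AddSubgroup.closure dilogRelators by
    have h := add_mem (hR x) hy
    rwa [hT0, sub_zero, sub_add_cancel] at h
  -- §2: the pre-Bloch side
  haveI := hK0
  obtain ⟨σ, hσ⟩ := exists_conj_ringHom hKc
  obtain ⟨c, hc⟩ := exists_conj_preBloch σ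
  let Φ : FreeAbelianGroup ℂ →+ PreBloch K :=
    FreeAbelianGroup.lift fun z => if h : z ∈ K then PreBloch.sym (⟨z, h⟩ : K) else 0
  have hΦa : ∀ (z : ℂ) (h : z ∈ K), Φ (of z) = PreBloch.sym (⟨z, h⟩ : K) :=
    fun z h => by simp only [Φ, lift_apply_of, dif_pos h]
  have hΦt : ∀ z, z ∉ K → Φ (of z) = 0 :=
    fun z h => by simp only [Φ, lift_apply_of, dif_neg h]
  set SN : Set (FreeAbelianGroup ℂ) := {c : FreeAbelianGroup ℂ | ∃ w : ℂ, w ∈ K ∧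
      c = of w + of (conj w)} ∪ {c | ∃ w : ℂ, w ∈ K ∧ w.im = 0 ∧ c = of w} with hSN
  set N : AddSubgroup (PreBloch K) := (AddSubgroup.closure SN).map Φ with hN
  have hSN_le : AddSubgroup.closure SN ≤ AddSubgroup.closure dilogRelators := by
    apply AddSubgroup.closure_mono
    rintro r (⟨w, hw, rfl⟩ | ⟨w, -, hw, rfl⟩)
    · exact of_add_of_conj_mem_dilogRelators (hKa' w hw)
    · exact of_real_mem_dilogRelators hw
  have hfix : N ≤ c.eqLocus (AddMonoidHom.id _) := by
    rw [hN, AddMonoidHom.map_closure, AddSubgroup.closure_le]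
    rintro _ ⟨r, (⟨w, hw, rfl⟩ | ⟨w, hw, hwim, rfl⟩), rfl⟩ <;> show c _ = _
    · rw [map_add, hΦa w hw, hΦa _ (hKc w hw), map_add, hc, hc, add_comm]
      congr 2
      · exact Subtype.ext (by rw [hσ]; exact Complex.conj_conj w)
      · exact Subtype.ext (by rw [hσ])
    · rw [hΦa w hw, hc]
      exact congrArg _ (Subtype.ext (by rw [hσ]; exact Complex.conj_eq_iff_im.2 hwim))
  have hgen : ∀ z : K, PreBloch.sym z + c (PreBloch.sym z) ∈ N := by
    intro z
    have e1 : Φ (of (z : ℂ)) = PreBloch.sym z := hΦa _ z.2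
    have e2 : Φ (of (conj (z : ℂ))) = PreBloch.sym (σ z) := by
      rw [hΦa _ (hKc _ z.2)]
      exact congrArg _ (Subtype.ext (by rw [hσ]))
    rw [hc, ← e1, ← e2, ← map_add]
    exact AddSubgroup.mem_map_of_mem Φ (AddSubgroup.subset_closure (Or.inl ⟨z, z.2, rfl⟩))
  have hΦx : Φ x ∈ N := by
    apply two_saturated_of_fixed c N (fun n hn => hfix hn) hgen
    rw [← map_nsmul]
    exact closure_le_comap_sym hKa Φ hΦa hΦt hx
  -- §3: back to `ℤ[ℂ]`
  obtain ⟨n, hn, hnx⟩ := AddSubgroup.mem_map.1 hΦx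
  let lam : FreeAbelianGroup ℂ →+ FreeAbelianGroup (PreBloch.Gen K) :=
    FreeAbelianGroup.lift fun z => if h : z ∈ K ∧ z ≠ 0 ∧ z ≠ 1 then
      of (⟨⟨z, h.1⟩, coe_ne_zero_one h⟩ : PreBloch.Gen K) else 0
  have hl₁ : ∀ z : ℂ, z ∈ K ∧ z ≠ 0 ∧ z ≠ 1 →
      ∃ g : PreBloch.Gen K, (g.val : ℂ) = z ∧ lam (of z) = of g :=
    fun z h => ⟨⟨⟨z, h.1⟩, coe_ne_zero_one h⟩, rfl, by simp only [lam, lift_apply_of, dif_pos h]⟩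
  have hl₂ : ∀ z : ℂ, ¬(z ∈ K ∧ z ≠ 0 ∧ z ≠ 1) → lam (of z) = 0 :=
    fun z h => by simp only [lam, lift_apply_of, dif_neg h]
  let ι : FreeAbelianGroup (PreBloch.Gen K) →+ FreeAbelianGroup ℂ :=
    FreeAbelianGroup.lift fun g => of (g.val : ℂ)
  have hι : ∀ g, ι (of g) = of (g.val : ℂ) := fun g => lift_apply_of _ _
  obtain ⟨hu₁, hu₂⟩ := lambda_facts Φ hΦa hΦt πA hA₁ hA₂ lam hl₁ hl₂ ι hι (x - n)
  rw [map_sub, hnx, sub_self, eq_comm, PreBloch.proj_eq_zero_iff] at hu₁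
  have h3 := add_mem hu₂ (closure_fiveTerm_le_comap hKa' ι hι hu₁)
  rw [sub_add_cancel, map_sub] at h3
  have h4 := add_mem h3 (hAC (hSN_le hn))
  rwa [sub_add_cancel] at h4

end Summit.KontsevichZagierPeriods.HyperbolicBloch.ZagierDilogarithm

end
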